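import Summits.CriticalPhenomena.CardyFormulaZ2.Theorems.CardyFlipRussoCoveringLegDefs
import Literature.Probability.RandomPlanarGeometry.LatticeSimilarityCovariance
import Literature.Probability.RandomPlanarGeometry.ZoomFlow
import HarnessLib

/-!
# Vocabulary of line `five-arm-null`, skeleton v3 ("shifted family"), for the crux `CardyFlipRusso.CoveringLeg`
(stmt-CriticalPhenomena-6435)

Route `CardyFlipRusso` (sub-problem `CriticalPhenomena/CardyFormulaZ2`), crux
`Summit.CriticalPhenomena.CardyFormulaZ2.Theses.CardyFlipRusso.CoveringLeg`: Cardy's formula for critical SITE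
percolation on the centred square lattice `G_s` (crude discretisation, frame A) IMPLIES Cardy's formula for
critical BOND percolation on `ℤ²` (crude discretisation `embDomainCrossing squareLatticeEmbedding.z`).

Second **definitions module** of the line (the first is `CardyFlipRussoCoveringLegDefs.lean`, p115880, whose
objects `SiteCardy`, `BondCardy`, `lawP`, `crossS`, `massII`, `massIII` are reused verbatim).  Skeleton v3
(lead `prover-line-stmt-CriticalPhenomena-6435-c1-0`, cycle 2) runs Beffara's `q`-interpolation for the
SHIFTED FAMILY of rectangles `R ⊕ δc := R.map (similarity 1 _ (δ·c))`, `c = i/√2`: route CardySectorGap's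
covering-adapted frame B is frame A rotated by `ρ = (1 − i)/√2` and translated by the non-period vector `i/√2`
(`frame_zS_eq`), and translating the rectangle by `δ·i/√2` at mesh `δ` undoes that translation, so that

* at `q = ½` the frame bridge from the crux hypothesis is EXACT (`Sig.stub_frameBridgeShift`; no site-side
  boundary estimate, unlike v2's `Sig.stub_frameBridge`), and
* at `q = 0` the residual `O(δ)` translation between Kesten's covering frame and bond-`ℤ²` is absorbed by the
  tree's PROVED mesh-uniform continuity of crude bond-`ℤ²` crossing probabilities
  (`CornerLineDescent.SymmetricSeed.stub_CrudeCrossingContinuity_of_SS` ∘ `QuadCrossing.SchrammSmirnov2011_lemma_5_1_holds`)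
  inside `Sig.stub_coveringBridgeShift`.

This file is sorry-free VOCABULARY: the four named statements of the shifted family (`CardyHalfShift`,
`PivotalBalanceShift`, `MixedInterpolationShift`, `MixedCardyZeroShift`), the four stub STATEMENTS
`Sig.stub_*Shift : Prop` (to be PROVED by helper files `Theorems/CardyFlipRussoCoveringLeg<Stub>.lean --supports
stmt-CriticalPhenomena-6435`; nothing is asserted here), the anchoring-uniform form `PivotalBalanceUniform` of
Beffara's eq. (5.1) with its two specialisations (to CardySectorGap's stmt-7049 at `w = 0` and to the shifted family
at `w = i/√2`), and the pure-logic glue `mixedCardyZeroShift_of`, `CoveringLeg_of_shiftStubs`.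

Sources: V. Beffara, *Is critical 2D percolation universal?*, Progr. Probab. 60 (2008) §5.1–5.2, Prop. 18, eq. (5.1)
[Beffara2008Universal]; H. Kesten, *Percolation theory for mathematicians* (1982) §3.4 [Kesten1982];
O. Schramm, S. Smirnov, Ann. Probab. 39 (2011) Lemma 5.1/6.1 [SchrammSmirnov2011].
-/

noncomputable section

namespace Summit.CriticalPhenomena.CardyFormulaZ2.Cruxes.CoveringLeg.FiveArmNull

open Filter Set Topology
open Literature.Probability.RandomPlanarGeometry Literature.Probability.Percolation
open Literature.Probability.LatticeModels
open Literature.Barriers.CriticalPhenomena (MixedSite mixedParam)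
open Summit.CriticalPhenomena.CardyFormulaZ2.Theses

/-! ### The shifted family: four named statements (route-posited, OPEN; nothing asserted) -/

/-- Cardy for the frame-B crude crossing probabilities at `q = ½` of the shifted family `R ⊕ δ·i/√2` (at `q = ½` the
law is `sitePercolation _ half`, `lawP_half`).  A route-posited OPEN statement (conclusion of `Sig.stub_frameBridgeShift`,
by which it is EQUIVALENT-in-use to the crux hypothesis; not a literature fact). -/
def CardyHalfShift : Prop :=
  ∀ R : ConformalRectangle, R.HasCrossingLimit
    (fun δ : ℝ => (lawP half).real
      (crossS (R.map (similarity 1 one_ne_zero ((δ : ℂ) * (Complex.I / (Real.sqrt 2 : ℂ))))) δ))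
    cardyFunction

/-- **Beffara's eq. (5.1) for the shifted anchoring** — THE conjecture of skeleton v3: for every conformal rectangle,
uniformly in `q ∈ [0,1]`, the type-II and type-III pivotal masses of the crude crossing of `R ⊕ δ·i/√2` at mesh `δ`
agree to `o(1)` as `δ → 0⁺`.  Same mathematical content as CardySectorGap's `VertexFacePivotalBalance` (stmt-7049,
the unshifted anchoring `w = 0`); both are specialisations of `PivotalBalanceUniform`.  A route-posited OPEN
statement (Beffara 2008 leaves eq. (5.1) open; not a literature fact). -/
def PivotalBalanceShift : Prop :=
  ∀ R : ConformalRectangle, ∀ ε : ℝ, 0 < ε → ∃ δ₀ : ℝ, 0 < δ₀ ∧ ∀ δ : ℝ, 0 < δ → δ < δ₀ →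
    ∀ q : unitInterval,
      |massII (R.map (similarity 1 one_ne_zero ((δ : ℂ) * (Complex.I / (Real.sqrt 2 : ℂ))))) q δ -
        massIII (R.map (similarity 1 one_ne_zero ((δ : ℂ) * (Complex.I / (Real.sqrt 2 : ℂ))))) q δ| < ε

/-- Universality along the shifted family: `P_{1/2}[cross] − P_0[cross] → 0` for `R ⊕ δ·i/√2` at mesh `δ`
(site-`G_s` at `½` and Kesten's encoding of bond-`ℤ²` cross alike).  A route-posited OPEN statement (conclusion of
`Sig.stub_russoShift`; not a literature fact). -/
def MixedInterpolationShift : Prop :=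
  ∀ R : ConformalRectangle, Tendsto (fun δ : ℝ =>
    (lawP half).real (crossS (R.map (similarity 1 one_ne_zero ((δ : ℂ) * (Complex.I / (Real.sqrt 2 : ℂ))))) δ) -
      (lawP 0).real (crossS (R.map (similarity 1 one_ne_zero ((δ : ℂ) * (Complex.I / (Real.sqrt 2 : ℂ))))) δ))
    (𝓝[>] 0) (𝓝 0)

/-- Cardy for the frame-B crude crossing probabilities at `q = 0` (Kesten's covering encoding of bond-`ℤ²`) of the
shifted family.  A route-posited OPEN statement (hypothesis of `Sig.stub_coveringBridgeShift`; not a literature fact). -/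
def MixedCardyZeroShift : Prop :=
  ∀ R : ConformalRectangle, R.HasCrossingLimit
    (fun δ : ℝ => (lawP 0).real
      (crossS (R.map (similarity 1 one_ne_zero ((δ : ℂ) * (Complex.I / (Real.sqrt 2 : ℂ))))) δ))
    cardyFunction

/-! ### The four stub statements of skeleton v3 (`Sig.stub_X` is the statement of the registered `stub_X`) -/

/-- STUB S1' — **FRAME BRIDGE, shifted family**: the crux hypothesis implies Cardy at `q = ½` along the shifted family.
EXACT (rigid transport: `ρ⁻¹·c = −w₀` cancels lead a1's residual half-cell shift).  Registered stub STATEMENT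
(nothing asserted). -/
def Sig.stub_frameBridgeShift : Prop :=
  SiteCardy → CardyHalfShift

/-- STUB S2' — **PIVOTAL BALANCE, shifted family** (`PivotalBalanceShift`, the conjecture).  Registered stub STATEMENT
(nothing asserted). -/
def Sig.stub_pivotalBalanceShift : Prop :=
  PivotalBalanceShift

/-- STUB S4' — **RUSSO IN `q`, shifted family**: Beffara's Prop. 18 + the mean value theorem at each mesh turn the
balance into the interpolation.  Registered stub STATEMENT (nothing asserted). -/
def Sig.stub_russoShift : Prop :=
  PivotalBalanceShift → MixedInterpolationShift

/-- STUB S5' — **KESTEN'S COVERING BRIDGE, shifted family**: Cardy at `q = 0` along the shifted family implies Cardy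
for crude bond-`ℤ²` crossings.  Registered stub STATEMENT (nothing asserted). -/
def Sig.stub_coveringBridgeShift : Prop :=
  MixedCardyZeroShift → BondCardy

/-! ### Certificates (`Iff.rfl`) — the expanded texts of the stubs -/

/-- S1' unfolded. [cite: Beffara2008Universal, §5.1] -/
theorem stub_frameBridgeShift_iff :
    Sig.stub_frameBridgeShift ↔ (SiteCardy → ∀ R : ConformalRectangle, R.HasCrossingLimit
      (fun δ : ℝ => (lawP half).real
        (crossS (R.map (similarity 1 one_ne_zero ((δ : ℂ) * (Complex.I / (Real.sqrt 2 : ℂ))))) δ))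
      cardyFunction) :=
  Iff.rfl

/-- S4' unfolded. [cite: Beffara2008Universal, §5.2 Prop. 18] -/
theorem stub_russoShift_iff :
    Sig.stub_russoShift ↔ (PivotalBalanceShift → MixedInterpolationShift) :=
  Iff.rfl

/-- S5' unfolded. [cite: Kesten1982, §3.4] -/
theorem stub_coveringBridgeShift_iff :
    Sig.stub_coveringBridgeShift ↔ (MixedCardyZeroShift → BondCardy) :=
  Iff.rfl

/-! ### The anchoring-uniform form of Beffara's eq. (5.1) and its two specialisations -/

/-- **Beffara's eq. (5.1), uniform in the anchoring of the lattice**: the vertex/face pivotal balance holds uniformly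
over all translates `R + δ w`, `‖w‖ ≤ 1`, of the rectangle by at most one mesh step.  Any scaling-limit proof of
eq. (5.1) is insensitive to the `O(δ)` position of the lattice, so this is the natural common strengthening of
CardySectorGap's stmt-7049 (`w = 0`) and of `PivotalBalanceShift` (`w = i/√2`).  A route-posited OPEN statement
(not a literature fact). -/
def PivotalBalanceUniform : Prop :=
  ∀ R : ConformalRectangle, ∀ ε : ℝ, 0 < ε → ∃ δ₀ : ℝ, 0 < δ₀ ∧ ∀ δ : ℝ, 0 < δ → δ < δ₀ →
    ∀ q : unitInterval, ∀ w : ℂ, ‖w‖ ≤ 1 →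
      |massII (R.map (similarity 1 one_ne_zero ((δ : ℂ) * w))) q δ -
        massIII (R.map (similarity 1 one_ne_zero ((δ : ℂ) * w))) q δ| < ε

/-- `‖i/√2‖ = 1/√2 ≤ 1`. [folklore] -/
theorem norm_shiftVec_le_one : ‖Complex.I / (Real.sqrt 2 : ℂ)‖ ≤ 1 := by
  rw [norm_div, Complex.norm_I, Complex.norm_real, Real.norm_eq_abs,
    abs_of_nonneg (Real.sqrt_nonneg 2), one_div]
  exact inv_le_one_of_one_le₀ (Real.one_le_sqrt.2 one_le_two)

/-- The uniform form at `w = i/√2` is the balance along the shifted family. [cite: Beffara2008Universal, §5.2 eq. (5.1)] -/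
theorem pivotalBalanceShift_of_uniform (hU : PivotalBalanceUniform) : PivotalBalanceShift := by
  intro R ε hε
  obtain ⟨δ₀, hδ₀, h⟩ := hU R ε hε
  exact ⟨δ₀, hδ₀, fun δ hδ hδlt q => h δ hδ hδlt q _ norm_shiftVec_le_one⟩

/-- The translate by `0` is the rectangle itself. [folklore] -/
theorem map_similarity_one_zero (R : ConformalRectangle) : R.map (similarity 1 one_ne_zero 0) = R := by
  have h : similarity 1 one_ne_zero 0 = Homeomorph.refl ℂ :=
    Homeomorph.ext fun p => by simp [similarity_apply]
  rw [h, MarkedDomain.map_refl]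

/-- The uniform form at `w = 0` is CardySectorGap's `VertexFacePivotalBalance` (stmt-CriticalPhenomena-7049) BY NAME.
[cite: Beffara2008Universal, §5.2 eq. (5.1)] -/
theorem vertexFacePivotalBalance_of_uniform (hU : PivotalBalanceUniform) :
    CardySectorGap.VertexFacePivotalBalance := by
  rw [vertexFacePivotalBalance_iff]
  intro R ε hε
  obtain ⟨δ₀, hδ₀, h⟩ := hU R ε hε
  refine ⟨δ₀, hδ₀, fun δ hδ hδlt q => ?_⟩
  have h0 := h δ hδ hδlt q 0 (by simp)
  rwa [mul_zero, map_similarity_one_zero] at h0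

/-! ### Glue (pure logic / one `Tendsto.sub`) -/

/-- **Cardy at `q = ½` + interpolation ⇒ Cardy at `q = 0`** along the shifted family (one `Tendsto.sub` inside each
uniformizing datum). [cite: Beffara2008Universal, §5.2] -/
theorem mixedCardyZeroShift_of (hC : CardyHalfShift) (hM : MixedInterpolationShift) : MixedCardyZeroShift := by
  intro R φ x hφ
  have h := (hC R φ x hφ).sub (hM R)
  simp only [sub_sub_cancel, sub_zero] at h
  exact h

/-- **The composition of skeleton v3** (glue only): frame bridge + pivotal balance + Russo in `q` + Kesten's covering
bridge along the shifted family imply `CoveringLeg`; the crux hypothesis `hSite` is consumed by S1'.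
[cite: Beffara2008Universal, §5.1–5.2] -/
theorem CoveringLeg_of_shiftStubs : Summit.CriticalPhenomena.CardyFormulaZ2.Cruxes.CoveringLeg.FiveArmNull.Sig.stub_frameBridgeShift → Summit.CriticalPhenomena.CardyFormulaZ2.Cruxes.CoveringLeg.FiveArmNull.Sig.stub_pivotalBalanceShift → Summit.CriticalPhenomena.CardyFormulaZ2.Cruxes.CoveringLeg.FiveArmNull.Sig.stub_russoShift → Summit.CriticalPhenomena.CardyFormulaZ2.Cruxes.CoveringLeg.FiveArmNull.Sig.stub_coveringBridgeShift → Summit.CriticalPhenomena.CardyFormulaZ2.Theses.CardyFlipRusso.CoveringLeg := by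
  intro hF hB hR hK
  exact coveringLeg_iff.2 fun hSite => hK (mixedCardyZeroShift_of (hF hSite) (hR hB))

/-! ### Skeleton v4 (lead `prover-line-stmt-CriticalPhenomena-6435-c2-0`, cycle 3): the calibrated stub

After wave 2 the composition consumes only `MixedInterpolationShift` (the INTEGRAL of Beffara's Russo integrand along
the shifted family; `coveringLeg_of_mixedInterpolationShift`, Reductions p122660), which is exactly frame-free site/bond
crossing universality (`mixedInterpolationShift_iff_universality`) and, under the crux hypothesis `SiteCardy`,
EQUIVALENT to the crux (`coveringLeg_iff_universality_of_siteCardy`, p123912).  Skeleton v4 therefore registers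
`MixedInterpolationShift` itself as its one stub, in the `Sig.stub_*` convention of this module; Beffara's eq. (5.1)
(`PivotalBalanceShift`, the v3 stub) stays a sufficient route to it (`Sig.stub_russoShift`, landed p121401). -/

/-- STUB (v4) — **SITE-`G_s`/BOND-`ℤ²` CROSSING UNIVERSALITY along the shifted family**: `MixedInterpolationShift`
itself (`P_{1/2}[cross] − P_0[cross] → 0` for `R ⊕ δ·i/√2` at mesh `δ`).  Registered stub STATEMENT of skeleton v4
(nothing asserted; OPEN — the site-`G_s`/bond-`ℤ²` instance of crossing universality). -/
def Sig.stub_mixedInterpolationShift : Prop :=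
  MixedInterpolationShift

/-- S (v4) unfolded: the v4 stub IS `MixedInterpolationShift`. [cite: Beffara2008Universal, §5.2] -/
theorem stub_mixedInterpolationShift_iff :
    Sig.stub_mixedInterpolationShift ↔ MixedInterpolationShift :=
  Iff.rfl

/-- **Beffara's eq. (5.1) route to the v4 stub** (glue): the v3 stubs S2' (pivotal balance) and S4' (Russo in `q`)
together give the v4 stub. [cite: Beffara2008Universal, §5.2 Prop. 18] -/
theorem stub_mixedInterpolationShift_of_shiftStubs : Summit.CriticalPhenomena.CardyFormulaZ2.Cruxes.CoveringLeg.FiveArmNull.Sig.stub_pivotalBalanceShift → Summit.CriticalPhenomena.CardyFormulaZ2.Cruxes.CoveringLeg.FiveArmNull.Sig.stub_russoShift → Summit.CriticalPhenomena.CardyFormulaZ2.Cruxes.CoveringLeg.FiveArmNull.Sig.stub_mixedInterpolationShift :=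
  fun hB hR => hR hB

/-- **The composition of skeleton v4** (glue only): frame bridge + the v4 stub + Kesten's covering bridge along the
shifted family imply `CoveringLeg`. [cite: Beffara2008Universal, §5.1–5.2] -/
theorem CoveringLeg_of_shiftStubs_v4 : Summit.CriticalPhenomena.CardyFormulaZ2.Cruxes.CoveringLeg.FiveArmNull.Sig.stub_frameBridgeShift → Summit.CriticalPhenomena.CardyFormulaZ2.Cruxes.CoveringLeg.FiveArmNull.Sig.stub_mixedInterpolationShift → Summit.CriticalPhenomena.CardyFormulaZ2.Cruxes.CoveringLeg.FiveArmNull.Sig.stub_coveringBridgeShift → Summit.CriticalPhenomena.CardyFormulaZ2.Theses.CardyFlipRusso.CoveringLeg := by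
  intro hF hM hK
  exact coveringLeg_iff.2 fun hSite => hK (mixedCardyZeroShift_of (hF hSite) hM)

end Summit.CriticalPhenomena.CardyFormulaZ2.Cruxes.CoveringLeg.FiveArmNull

end
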